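import Literature.MathematicalPhysics.QuantumFieldTheory.Chatterjee2019LargeN.WilsonLoopFactorization
import HarnessLib

/-!
# Chatterjee 2019, §4: the first-order strong-coupling coefficient of the plaquette, `a₁((p)) = 1`

S. Chatterjee, *Rigorous solution of strongly coupled `SO(N)` lattice gauge theory in the large `N` limit*,
Comm. Math. Phys. **366** (2019) 203–268 (arXiv:1502.07719).  **§4** (last paragraph): «take … `s` to be a single
plaquette … The first six coefficients … turn out to be `a₀ = 0, a₁ = 1, a₂ = a₃ = a₄ = 0, a₅ = −7`»; equivalently
«`lim ⟨W_p⟩/N = β − 7β⁵ + O(β⁶)`».  The tree has `a₀ = 0` (`AreaLowerBound.coeffA_plaquette_zero`, Lemma 14.1).  This file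
proves **`a₁((p)) = 1` for every plaquette `p` of `ℤᵈ`** (any `d`; `d = 3` is the printed table's `k = 1` row) from the
reduction `WilsonLoopFactorization.length_mul_coeffA_singleton_one` (`|l|·a₁((l)) = #{null l ⊖ₓ q} − #{null l ⊕ₓ q}`):
for `l = ∂p` the null deformations are exactly the four `∂p ⊖ₓ p` (`x` the four locations), and no `∂p ⊕ₓ q` or
`∂p ⊖ₓ q`, `q ≠ p`, is null (their 1-chains are `r(p) ± r(q) ≠ 0`, §14's bookkeeping), so `4·a₁ = 4`.

Main results: `coeffA_plaquette_one : coeffA [plaquetteWord p] 1 = 1`; `plaquetteCoefficientsZ3_one` (the `k = 1` row of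
the named fact `PlaquetteCoefficientsZ3`); lemmas `negDeform_plaquetteWord_self` (`∂p ⊖ₓ p = ∅`),
`posDeform_plaquetteWord_ne_nil`, `negDeform_plaquetteWord_ne_nil` (`q ≠ p`), `eq_of_plaquetteChain_eq_smul`
(`δp = ±δq ⇒ p = q`), `plaquetteLoc_plaquetteWord`, `mem_plaquettesAt_plaquetteWord`.

## WHAT THIS IS NOT
The rows `k = 2, …, 5` of `PlaquetteCoefficientsZ3` (`a₂ = a₃ = a₄ = 0`, `a₅ = −7`) are a large finite enumeration and
remain open; nothing here bears on four-dimensional Yang–Mills or a mass gap.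
-/

noncomputable section

open Finset
open scoped BigOperators
open Literature.Probability.LatticeModels Literature.MathematicalPhysics.QuantumLattice

namespace Literature.MathematicalPhysics.QuantumFieldTheory.Chatterjee2019LargeN

variable {d : ℕ}

namespace PlaquetteFirstOrderProof

/-- `x + eₖ ≠ x`. [folklore] -/
private theorem add_single_ne (y : Literature.Probability.LatticeModels.Site d) (k : Fin d) : y + Pi.single k (1 : ℤ) ≠ y := by
  intro h; have := congrFun h k; simp at this

/-- `x ≠ x + eₖ`. [folklore] -/
private theorem ne_add_single (y : Literature.Probability.LatticeModels.Site d) (k : Fin d) : y ≠ y + Pi.single k (1 : ℤ) := (add_single_ne y k).symm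

/-- `x + e_a = x + e_b ⇒ a = b`. [folklore] -/
private theorem single_add_cancel {y : Literature.Probability.LatticeModels.Site d} {a b : Fin d} (h : y + Pi.single a (1 : ℤ) = y + Pi.single b 1) :
    a = b := by
  by_contra hab
  have := congrFun (add_left_cancel h) b
  simp [hab] at this

/-- `δq` is supported on the four edges of `q`. [cite: Chatterjee2019LargeN, §3 (δp = e₁ + e₂ − e₃ − e₄)] -/
theorem plaquetteChain_apply_ne_zero {q : ZdPlaquette d} {f : Literature.MathematicalPhysics.QuantumLattice.ZdEdge d}
    (h : plaquetteChain q f ≠ 0) : f ∈ plaquetteEdges q := by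
  by_contra hf
  apply h
  simp only [plaquetteEdges, Finset.mem_insert, Finset.mem_singleton, not_or] at hf
  obtain ⟨h1, h2, h3, h4⟩ := hf
  simp [plaquetteChain, wordChain, plaquetteWord, edgeChain, Ne.symm h1, Ne.symm h2, Ne.symm h3, Ne.symm h4]

/-- The coefficient of the last edge `e₄ = (x, i)` of `p` (plane `i < j`) in `δp` is `−1`.
[cite: Chatterjee2019LargeN, §3 (δp = e₁ + e₂ − e₃ − e₄)] -/
theorem plaquetteChain_apply_snd (p : ZdPlaquette d) : plaquetteChain p (p.1, p.2.1.1) = -1 := by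
  obtain ⟨x, ⟨⟨i, j⟩, hij⟩⟩ := p
  have hne : j ≠ i := (ne_of_lt hij).symm
  have h2 : x + Pi.single j (1 : ℤ) ≠ x := add_single_ne x j
  simp only [plaquetteChain, wordChain, plaquetteWord, List.map_cons, List.map_nil, List.sum_cons, List.sum_nil,
    edgeChain, Finsupp.add_apply, Finsupp.single_apply, Prod.mk.injEq, add_zero]
  simp [hne, h2]

/-- **`δp = ±δq ⇒ p = q`**: a plaquette is determined by its differential (the edges `(x, j)` and `(x, i)` of `p` must be
edges of `q`). [cite: Chatterjee2019LargeN, §3 (the differential map δ; a plaquette as a lattice surface)] -/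
theorem eq_of_plaquetteChain_eq_smul {p q : ZdPlaquette d} {τ : ℤ} (hτ : τ = 1 ∨ τ = -1)
    (h : plaquetteChain p = τ • plaquetteChain q) : p = q := by
  have hτ0 : τ ≠ 0 := by rcases hτ with rfl | rfl <;> decide
  obtain ⟨x, ⟨⟨i, j⟩, hij⟩⟩ := p
  obtain ⟨y, ⟨⟨i', j'⟩, hij'⟩⟩ := q
  have hE1 : ((x, j) : Literature.MathematicalPhysics.QuantumLattice.ZdEdge d) ∈ plaquetteEdges (y, ⟨(i', j'), hij'⟩) := by
    apply plaquetteChain_apply_ne_zero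
    intro h0
    have h1 := plaquetteChain_apply_fst (x, ⟨(i, j), hij⟩)
    rw [h, Finsupp.smul_apply, smul_eq_mul] at h1
    simp only at h0 h1
    rw [h0, mul_zero] at h1
    exact zero_ne_one h1
  have hE4 : ((x, i) : Literature.MathematicalPhysics.QuantumLattice.ZdEdge d) ∈ plaquetteEdges (y, ⟨(i', j'), hij'⟩) := by
    apply plaquetteChain_apply_ne_zero
    intro h0
    have h1 := plaquetteChain_apply_snd (x, ⟨(i, j), hij⟩)
    rw [h, Finsupp.smul_apply, smul_eq_mul] at h1
    simp only at h0 h1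
    rw [h0, mul_zero] at h1
    norm_num at h1
  have hij0 : i < j := hij
  have hij0' : i' < j' := hij'
  simp only [plaquetteEdges, Finset.mem_insert, Finset.mem_singleton, Prod.mk.injEq] at hE1 hE4
  have A := add_single_ne y
  have B := ne_add_single y
  rcases hE1 with ⟨hx1, hd1⟩ | ⟨hx1, hd1⟩ | ⟨hx1, hd1⟩ | ⟨hx1, hd1⟩ <;>
    rcases hE4 with ⟨hx4, hd4⟩ | ⟨hx4, hd4⟩ | ⟨hx4, hd4⟩ | ⟨hx4, hd4⟩
  all_goals have hyy := hx1.symm.trans hx4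
  all_goals first
    | omega
    | exact absurd hyy (A _)
    | exact absurd hyy (B _)
    | (have hab := single_add_cancel hyy; omega)
    | (subst hd1; subst hd4; subst hx1; rfl)

/-- The marked location of the edge of the `x₀`-th letter of `∂p` in `∂p` is `x₀` (the four edges are distinct).
[cite: Chatterjee2019LargeN, §2.2 (the unique location of e in p)] -/
theorem plaquetteLoc_plaquetteWord (p : ZdPlaquette d) (x₀ : Fin (plaquetteWord p).length) :
    Word.plaquetteLoc p ((plaquetteWord p).get x₀).1 = x₀ := by
  obtain ⟨x, ⟨⟨i, j⟩, hij⟩⟩ := p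
  have hne : i ≠ j := ne_of_lt hij
  have h1 : ∀ k : Fin d, x + Pi.single k (1 : ℤ) ≠ x := add_single_ne x
  have h2 : ∀ k : Fin d, x ≠ x + Pi.single k (1 : ℤ) := ne_add_single x
  have h3 : x + Pi.single j (1 : ℤ) ≠ x + Pi.single i 1 := fun h => hne (single_add_cancel h).symm
  match x₀ with
  | ⟨0, _⟩ => simp [Word.plaquetteLoc, plaquetteWord, List.findIdx_cons]
  | ⟨1, _⟩ => simp [Word.plaquetteLoc, plaquetteWord, List.findIdx_cons, hne.symm, h2]
  | ⟨2, _⟩ => simp [Word.plaquetteLoc, plaquetteWord, List.findIdx_cons, hne, h2, h3]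
  | ⟨3, _⟩ => simp [Word.plaquetteLoc, plaquetteWord, List.findIdx_cons, hne.symm, h1]

/-- `p ∈ 𝒫⁺(e)` for every edge `e` of `∂p`. [cite: Chatterjee2019LargeN, §2.2 (𝒫⁺(e))] -/
theorem mem_plaquettesAt_plaquetteWord (p : ZdPlaquette d) (x₀ : Fin (plaquetteWord p).length) :
    p ∈ plaquettesAt ((plaquetteWord p).get x₀) := by
  rw [plaquettesAt, mem_plaquettesTouching_iff]
  refine ⟨((plaquetteWord p).get x₀).1, Finset.mem_inter.2 ⟨?_, Finset.mem_singleton_self _⟩⟩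
  obtain ⟨x, ⟨⟨i, j⟩, hij⟩⟩ := p
  match x₀ with
  | ⟨0, _⟩ => simp [plaquetteWord, plaquetteEdges]
  | ⟨1, _⟩ => simp [plaquetteWord, plaquetteEdges]
  | ⟨2, _⟩ => simp [plaquetteWord, plaquetteEdges]
  | ⟨3, _⟩ => simp [plaquetteWord, plaquetteEdges]

/-- The rotated plaquette word used by a deformation of `∂p` by `p` itself at `x₀` is `∂p` read from `x₀`.
[cite: Chatterjee2019LargeN, §2.2 (l ⊕ₓ p, l ⊖ₓ p)] -/
theorem rotate_plaquetteLoc_self (p : ZdPlaquette d) (x₀ : Fin (plaquetteWord p).length) :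
    (plaquetteWord p).rotate (Word.plaquetteLoc p ((plaquetteWord p).letter x₀).1) = (plaquetteWord p).rotate x₀ := by
  rw [Word.letter, plaquetteLoc_plaquetteWord]

/-- **`∂p ⊖ₓ p = ∅`**: removing the plaquette from its own boundary gives the null loop (`[b⁻¹ b] = ∅`).
[cite: Chatterjee2019LargeN, §4 (a₁ = 1: the trajectories ∂p ⊖ₓ p → ∅), §2.2 (negative deformation)] -/
theorem negDeform_plaquetteWord_self (p : ZdPlaquette d) (x₀ : Fin (plaquetteWord p).length) :
    Word.negDeform (plaquetteWord p) x₀ p = [] := by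
  rw [Word.negDeform, rotate_plaquetteLoc_self, Word.rotate_eq_letter_cons_drop, Word.negMergeRot, if_pos rfl, core,
    FreeGroup.reduce.eq_of_red (red_invRev_append_self _)]
  exact core_nil

/-- **`∂p ⊕ₓ p ≠ ∅`** (going around twice: `r = 2δp ≠ 0`). [cite: Chatterjee2019LargeN, §2.2 (positive deformation), §3 (δp)] -/
theorem posDeform_plaquetteWord_self_ne_nil (p : ZdPlaquette d) (x₀ : Fin (plaquetteWord p).length) :
    Word.posDeform (plaquetteWord p) x₀ p ≠ [] := by
  intro h
  have hc := congrArg wordChain h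
  rw [Word.posDeform, rotate_plaquetteLoc_self, Word.rotate_eq_letter_cons_drop, Word.posMergeRot, if_pos rfl,
    wordChain_core, wordChain_nil] at hc
  have hR : wordChain ((plaquetteWord p).letter x₀ :: List.drop 1 ((plaquetteWord p).rotate x₀)) = plaquetteChain p := by
    rw [← Word.rotate_eq_letter_cons_drop, wordChain_rotate, plaquetteChain]
  have h2 : (2 : ℤ) • plaquetteChain p = 0 := by
    rw [← hc, two_smul, ← hR]
    simp only [wordChain_append, wordChain_cons]
  have h3 := congrArg (fun c => c (p.1, p.2.1.2)) h2
  simp only [Finsupp.smul_apply, plaquetteChain_apply_fst, smul_eq_mul, mul_one, Finsupp.coe_zero, Pi.zero_apply] at h3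
  exact two_ne_zero h3

/-- A deformation of `∂p` by `q ≠ p` is never null: its 1-chain is `δp ± δq ≠ 0`.
[cite: Chatterjee2019LargeN, §14 (proof of Lemma 14.1: r(l ⊖ l') = r(l) ∓ r(l')), §3 (δ)] -/
theorem negDeform_plaquetteWord_ne_nil {p q : ZdPlaquette d} (x₀ : Fin (plaquetteWord p).length)
    (hq : q ∈ plaquettesAt ((plaquetteWord p).get x₀)) (hqp : q ≠ p) : Word.negDeform (plaquetteWord p) x₀ q ≠ [] := by
  intro h
  obtain ⟨σ, hσ, hc⟩ := Word.wordChain_negDeform (plaquetteWord p) x₀ hq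
  rw [h, wordChain_nil] at hc
  have hc' : plaquetteChain p = (-σ) • plaquetteChain q := by
    rw [neg_smul, eq_neg_iff_add_eq_zero]
    exact hc.symm
  exact hqp (eq_of_plaquetteChain_eq_smul (by rcases hσ with rfl | rfl <;> simp) hc').symm

/-- No positive deformation of `∂p` is null (`δp ± δq ≠ 0` for `q ≠ p`; `2δp ≠ 0` for `q = p`).
[cite: Chatterjee2019LargeN, §14 (r(l ⊕ l') = r(l) ± r(l')), §3 (δ)] -/
theorem posDeform_plaquetteWord_ne_nil {p q : ZdPlaquette d} (x₀ : Fin (plaquetteWord p).length)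
    (hq : q ∈ plaquettesAt ((plaquetteWord p).get x₀)) : Word.posDeform (plaquetteWord p) x₀ q ≠ [] := by
  by_cases hqp : q = p
  · subst hqp; exact posDeform_plaquetteWord_self_ne_nil _ x₀
  intro h
  obtain ⟨σ, hσ, hc⟩ := Word.wordChain_posDeform (plaquetteWord p) x₀ hq
  rw [h, wordChain_nil] at hc
  have hc' : plaquetteChain p = (-σ) • plaquetteChain q := by
    rw [neg_smul, eq_neg_iff_add_eq_zero]
    exact hc.symm
  exact hqp (eq_of_plaquetteChain_eq_smul (by rcases hσ with rfl | rfl <;> simp) hc').symm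

end PlaquetteFirstOrderProof

open PlaquetteFirstOrderProof

/-- ★ **`a₁((p)) = 1` for every plaquette `p`** — the `k = 1` coefficient of §4's expansion `lim ⟨W_p⟩/N = β − 7β⁵ + O(β⁶)`
(«`a₁ = 1`»), in every dimension: `4·a₁ = #{null ∂p ⊖ₓ q} − #{null ∂p ⊕ₓ q} = 4 − 0`.
[cite: Chatterjee2019LargeN, §4 (last paragraph: a₁ = 1)] -/
theorem coeffA_plaquette_one (p : ZdPlaquette d) : coeffA [plaquetteWord p] 1 = 1 := by
  classical
  have hl := isLoop_plaquetteWord p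
  have hne : plaquetteWord p ≠ [] := by simp [plaquetteWord]
  have h := length_mul_coeffA_singleton_one hl hne
  -- no positive deformation of `∂p` is null
  have h2 : (Finset.univ.filter fun o : DeformIdx [plaquetteWord p] =>
      Word.posDeform ([plaquetteWord p].get o.1) o.2.1 o.2.2.1 = []).card = 0 := by
    rw [Finset.card_eq_zero, Finset.filter_eq_empty_iff]
    rintro ⟨⟨i, hi⟩, x₀, q, hq⟩ -
    have hi0 : i = 0 := by simp only [List.length_singleton] at hi; omega
    subst hi0
    exact posDeform_plaquetteWord_ne_nil x₀ hq
  -- exactly the four `∂p ⊖ₓ p` are null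
  have h1 : (Finset.univ.filter fun o : DeformIdx [plaquetteWord p] =>
      Word.negDeform ([plaquetteWord p].get o.1) o.2.1 o.2.2.1 = []).card = 4 := by
    let f : Fin (plaquetteWord p).length → DeformIdx [plaquetteWord p] :=
      fun x₀ => ⟨⟨0, Nat.zero_lt_one⟩, x₀, ⟨p, mem_plaquettesAt_plaquetteWord p x₀⟩⟩
    have hf : Function.Injective f := by
      intro a b hab
      simp only [f, Sigma.mk.injEq, heq_eq_eq, true_and] at hab
      exact hab.1
    have hset : (Finset.univ.filter fun o : DeformIdx [plaquetteWord p] =>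
        Word.negDeform ([plaquetteWord p].get o.1) o.2.1 o.2.2.1 = []) = Finset.univ.map ⟨f, hf⟩ := by
      ext o
      simp only [Finset.mem_filter, Finset.mem_univ, true_and, Finset.mem_map, Function.Embedding.coeFn_mk]
      constructor
      · intro ho
        obtain ⟨⟨i, hi⟩, x₀, q, hq⟩ := o
        have hi0 : i = 0 := by simp only [List.length_singleton] at hi; omega
        subst hi0
        have hqp : q = p := by
          by_contra hqp
          exact negDeform_plaquetteWord_ne_nil x₀ hq hqp ho
        subst hqp
        exact ⟨x₀, rfl⟩
      · rintro ⟨x₀, rfl⟩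
        exact negDeform_plaquetteWord_self p x₀
    rw [hset, Finset.card_map, Finset.card_univ, Fintype.card_fin, length_plaquetteWord]
  rw [h1, h2, length_plaquetteWord] at h
  norm_num at h
  linarith

/-- The `k = 1` row of the printed table (`PlaquetteCoefficientsZ3`): `a₁((p)) = 1` for a plaquette of `ℤ³`.
[cite: Chatterjee2019LargeN, §4 (last paragraph: a₁ = 1)] -/
theorem plaquetteCoefficientsZ3_one (p : ZdPlaquette 3) : coeffA [plaquetteWord p] 1 = (plaquetteCoeffZ3 1 : ℝ) := by
  rw [coeffA_plaquette_one]
  simp [plaquetteCoeffZ3]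


end Literature.MathematicalPhysics.QuantumFieldTheory.Chatterjee2019LargeN

end
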